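import Literature.Combinatorics.LorentzianPolynomials.Diagonalization
import HarnessLib

/-!
# The product of Lorentzian polynomials is Lorentzian (Brändén–Huh 2020, Cor. 2.32)

Layer `Literature/Combinatorics/LorentzianPolynomials`, namespace `Literature.Combinatorics.LorentzianPolynomials`;
lane `lit-hodgefound` (Track 2 foundations library), seat p16, generation 28 (row g28-#10). Brändén–Huh's Corollary 2.32
("The product of strongly log-concave homogeneous polynomials is strongly log-concave"), in its Lorentzian form given by
the printed proof: for `f ∈ L^d_n` and `g ∈ L^e_n`, "`f(w)g(u)` is an element of `L^{d+e}_{n+n}`, where `u` is a set of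
variables disjoint from `w`" and hence "`f(w)g(w)` is an element of `L^{d+e}_n`, since setting `u = w` preserves the
Lorentzian property by Theorem 2.10" (the tree's `rename_mem_lorentzian_of_any`, `Diagonalization.lean`). The
"straightforward" first step is done here on Def. 2.6 directly, by induction on `d + e` along
`∂_{w_i}(f(w)g(u)) = (∂_i f)(w) g(u)`, `∂_{u_j}(f(w)g(u)) = f(w)(∂_j g)(u)`: the support of `f(w)g(u)` is the product of the
two supports (M-convex), and in the base case `d = e = 1` the Hessian `[[0, abᵀ], [baᵀ, 0]]` of a product of two linear
forms `(a·w)(b·u)`, `a, b ≥ 0`, is non-positive on the hyperplane orthogonal to `(a, b)`, so has at most one positive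
eigenvalue.

## Source (verbatim) — P. Brändén, J. Huh, *Lorentzian polynomials* [BrandenHuh2019] (held `paper:arxiv-1902.03719`)

§2.5, Corollary 2.32: "The product of strongly log-concave homogeneous polynomials is strongly log-concave. *Proof.* Let
`f(w)` be an element of `L^d_n`, and let `g(w)` be an element of `L^e_n`. It is straightforward to check that `f(w)g(u)` is
an element of `L^{d+e}_{n+n}`, where `u` is a set of variables disjoint from `w`. It follows that `f(w)g(w)` is an element
of `L^{d+e}_n`, since setting `u = w` preserves the Lorentzian property by Theorem 2.10." (With Thm. 2.30: for
homogeneous polynomials, strongly log-concave = Lorentzian.) "Corollary 2.32 extends the following theorem of Liggett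
[Liggett]: The convolution product of two ultra log-concave sequences with no internal zeros is an ultra log-concave
sequence with no internal zeros."

## What is here (`f : MvPolynomial σ ℝ`, `g : MvPolynomial τ ℝ`, finite types)

* §1 exponents on `σ ⊕ τ`: `restrInl`, `restrInr`, `mapDomain_inl_add_mapDomain_inr_eq_iff`, `eq_mapDomain_add_mapDomain`;
* §2 `disjointMul f g = f(w) g(u)` (`rename inl f * rename inr g`): **`coeff_disjointMul`**
  (`coeff_γ = coeff_{γ|σ} f · coeff_{γ|τ} g`), nonnegativity, homogeneity, `support_disjointMul`,
  **`isMConvex_support_disjointMul`**, `pderiv_inl_disjointMul`, `pderiv_inr_disjointMul`, `disjointMul_C_right/left`;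
* §3 the base case: `hessian_disjointMul_of_linear`, **`sigPos_rankTwo_le_one`** (`[[0, abᵀ],[baᵀ, 0]]`),
  `disjointMul_mem_lorentzian_one_one`;
* §4 **`disjointMul_mem_lorentzian`** (`f ∈ L^d_σ`, `g ∈ L^e_τ` ⟹ `f(w)g(u) ∈ L^{d+e}_{σ ⊕ τ}`), and Cor. 2.32:
  **`mul_mem_lorentzian`** (`f g ∈ L^{d+e}_σ`), `pow_mem_lorentzian`, `prod_mem_lorentzian`.

One definition with body (`disjointMul`; `restrInl`/`restrInr` are abbreviations of Mathlib's
`Finsupp.sumFinsuppEquivProdFinsupp`), theorems otherwise; no `sorry`, no named fact (net debt 0).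

## References

* [BrandenHuh2019] P. Brändén, J. Huh, *Lorentzian polynomials*, Ann. of Math. (2) 192 (2020) 821–891, arXiv:1902.03719 —
  §2.5 Cor. 2.32 and its proof; §2.2 Def. 2.6, Thm. 2.10.
-/

noncomputable section

open MvPolynomial Finsupp Finset
open Literature.LinearAlgebra.QuadraticForm

namespace Literature.Combinatorics.LorentzianPolynomials

variable {σ τ : Type*}

/-! ## §1 Exponents on `σ ⊕ τ` -/

section Exponents

/-- The `σ`-part `γ|_σ` of an exponent on `σ ⊕ τ`. [cite: BrandenHuh2019, §2.5 proof of Cor. 2.32 ("`f(w)g(u)` […] where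
`u` is a set of variables disjoint from `w`")] -/
abbrev restrInl (γ : σ ⊕ τ →₀ ℕ) : σ →₀ ℕ := (Finsupp.sumFinsuppEquivProdFinsupp γ).1

/-- The `τ`-part `γ|_τ` of an exponent on `σ ⊕ τ`. [cite: BrandenHuh2019, §2.5 proof of Cor. 2.32] -/
abbrev restrInr (γ : σ ⊕ τ →₀ ℕ) : τ →₀ ℕ := (Finsupp.sumFinsuppEquivProdFinsupp γ).2

/-- `γ|_σ (i) = γ (inl i)`. [cite: BrandenHuh2019, §2.5 proof of Cor. 2.32] -/
@[simp] theorem restrInl_apply (γ : σ ⊕ τ →₀ ℕ) (i : σ) : restrInl γ i = γ (Sum.inl i) :=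
  Finsupp.fst_sumFinsuppEquivProdFinsupp γ i

/-- `γ|_τ (j) = γ (inr j)`. [cite: BrandenHuh2019, §2.5 proof of Cor. 2.32] -/
@[simp] theorem restrInr_apply (γ : σ ⊕ τ →₀ ℕ) (j : τ) : restrInr γ j = γ (Sum.inr j) :=
  Finsupp.snd_sumFinsuppEquivProdFinsupp γ j

/-- `(ι_σ α + ι_τ β)(inl i) = α i`. [cite: BrandenHuh2019, §2.5 proof of Cor. 2.32] -/
theorem mapDomain_add_mapDomain_inl (α : σ →₀ ℕ) (β : τ →₀ ℕ) (i : σ) :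
    (Finsupp.mapDomain Sum.inl α + Finsupp.mapDomain Sum.inr β : σ ⊕ τ →₀ ℕ) (Sum.inl i) = α i := by
  rw [Finsupp.add_apply, Finsupp.mapDomain_apply Sum.inl_injective,
    Finsupp.mapDomain_notin_range _ _ (fun ⟨j, hj⟩ ↦ Sum.inr_ne_inl hj), add_zero]

/-- `(ι_σ α + ι_τ β)(inr j) = β j`. [cite: BrandenHuh2019, §2.5 proof of Cor. 2.32] -/
theorem mapDomain_add_mapDomain_inr (α : σ →₀ ℕ) (β : τ →₀ ℕ) (j : τ) :
    (Finsupp.mapDomain Sum.inl α + Finsupp.mapDomain Sum.inr β : σ ⊕ τ →₀ ℕ) (Sum.inr j) = β j := by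
  rw [Finsupp.add_apply, Finsupp.mapDomain_apply Sum.inr_injective,
    Finsupp.mapDomain_notin_range _ _ (fun ⟨i, hi⟩ ↦ Sum.inl_ne_inr hi), zero_add]

/-- **Unique decomposition of exponents on `σ ⊕ τ`**: `ι_σ α + ι_τ β = γ` iff `α = γ|_σ` and `β = γ|_τ`.
[cite: BrandenHuh2019, §2.5 proof of Cor. 2.32] -/
theorem mapDomain_inl_add_mapDomain_inr_eq_iff {α : σ →₀ ℕ} {β : τ →₀ ℕ} {γ : σ ⊕ τ →₀ ℕ} :
    Finsupp.mapDomain Sum.inl α + Finsupp.mapDomain Sum.inr β = γ ↔ α = restrInl γ ∧ β = restrInr γ := by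
  constructor
  · rintro rfl
    exact ⟨Finsupp.ext fun i ↦ by rw [restrInl_apply, mapDomain_add_mapDomain_inl],
      Finsupp.ext fun j ↦ by rw [restrInr_apply, mapDomain_add_mapDomain_inr]⟩
  · rintro ⟨rfl, rfl⟩
    ext x
    cases x with
    | inl i => rw [mapDomain_add_mapDomain_inl, restrInl_apply]
    | inr j => rw [mapDomain_add_mapDomain_inr, restrInr_apply]

/-- `γ = ι_σ (γ|_σ) + ι_τ (γ|_τ)`. [cite: BrandenHuh2019, §2.5 proof of Cor. 2.32] -/
theorem eq_mapDomain_add_mapDomain (γ : σ ⊕ τ →₀ ℕ) :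
    γ = Finsupp.mapDomain Sum.inl (restrInl γ) + Finsupp.mapDomain Sum.inr (restrInr γ) :=
  (mapDomain_inl_add_mapDomain_inr_eq_iff.2 ⟨rfl, rfl⟩).symm

/-- `(γ - e_{inl i} + e_{inl j})|_σ = γ|_σ - e_i + e_j` and `(…)|_τ = γ|_τ` (exchanges inside `σ`).
[cite: BrandenHuh2019, §2.5 proof of Cor. 2.32; §2.2 (p. 11, the exchange property)] -/
theorem restr_sub_inl_add_inl (γ : σ ⊕ τ →₀ ℕ) (i j : σ) :
    restrInl (γ - Finsupp.single (Sum.inl i) 1 + Finsupp.single (Sum.inl j) 1) =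
        restrInl γ - Finsupp.single i 1 + Finsupp.single j 1 ∧
      restrInr (γ - Finsupp.single (Sum.inl i) 1 + Finsupp.single (Sum.inl j) 1) = restrInr γ := by
  classical
  refine ⟨Finsupp.ext fun k ↦ ?_, Finsupp.ext fun k ↦ ?_⟩
  · simp only [restrInl_apply, Finsupp.add_apply, Finsupp.tsub_apply, Finsupp.single_apply, Sum.inl.injEq]
  · simp only [restrInr_apply, Finsupp.add_apply, Finsupp.tsub_apply, Finsupp.single_apply, reduceCtorEq, if_false,
      tsub_zero, add_zero]

/-- The same for exchanges inside `τ`. [cite: BrandenHuh2019, §2.5 proof of Cor. 2.32; §2.2 (p. 11)] -/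
theorem restr_sub_inr_add_inr (γ : σ ⊕ τ →₀ ℕ) (i j : τ) :
    restrInr (γ - Finsupp.single (Sum.inr i) 1 + Finsupp.single (Sum.inr j) 1) =
        restrInr γ - Finsupp.single i 1 + Finsupp.single j 1 ∧
      restrInl (γ - Finsupp.single (Sum.inr i) 1 + Finsupp.single (Sum.inr j) 1) = restrInl γ := by
  classical
  refine ⟨Finsupp.ext fun k ↦ ?_, Finsupp.ext fun k ↦ ?_⟩
  · simp only [restrInr_apply, Finsupp.add_apply, Finsupp.tsub_apply, Finsupp.single_apply, Sum.inr.injEq]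
  · simp only [restrInl_apply, Finsupp.add_apply, Finsupp.tsub_apply, Finsupp.single_apply, reduceCtorEq, if_false,
      tsub_zero, add_zero]

end Exponents

/-! ## §2 `f(w) g(u)` on disjoint sets of variables -/

section DisjointMul

/-- **`f(w) g(u)`**, the product of `f ∈ ℝ[w_σ]` and `g ∈ ℝ[u_τ]` in the disjoint variables `σ ⊕ τ`.
[cite: BrandenHuh2019, §2.5 proof of Cor. 2.32 ("`f(w)g(u)` […] where `u` is a set of variables disjoint from `w`")] -/
def disjointMul (f : MvPolynomial σ ℝ) (g : MvPolynomial τ ℝ) : MvPolynomial (σ ⊕ τ) ℝ :=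
  rename Sum.inl f * rename Sum.inr g

/-- Unfolding `disjointMul`. [cite: BrandenHuh2019, §2.5 proof of Cor. 2.32] -/
theorem disjointMul_def (f : MvPolynomial σ ℝ) (g : MvPolynomial τ ℝ) :
    disjointMul f g = rename Sum.inl f * rename Sum.inr g := rfl

/-- **The coefficients of `f(w) g(u)`**: `coeff_γ (f(w)g(u)) = coeff_{γ|_σ} f · coeff_{γ|_τ} g`.
[cite: BrandenHuh2019, §2.5 proof of Cor. 2.32] -/
theorem coeff_disjointMul (f : MvPolynomial σ ℝ) (g : MvPolynomial τ ℝ) (γ : σ ⊕ τ →₀ ℕ) :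
    coeff γ (disjointMul f g) = coeff (restrInl γ) f * coeff (restrInr γ) g := by
  classical
  have hf : rename (Sum.inl : σ → σ ⊕ τ) f =
      ∑ α ∈ f.support, monomial (Finsupp.mapDomain (Sum.inl : σ → σ ⊕ τ) α) (coeff α f) := by
    conv_lhs => rw [f.as_sum]
    rw [map_sum]
    exact Finset.sum_congr rfl fun α _ ↦ rename_monomial _ _ _
  have hg : rename (Sum.inr : τ → σ ⊕ τ) g =
      ∑ β ∈ g.support, monomial (Finsupp.mapDomain (Sum.inr : τ → σ ⊕ τ) β) (coeff β g) := by
    conv_lhs => rw [g.as_sum]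
    rw [map_sum]
    exact Finset.sum_congr rfl fun β _ ↦ rename_monomial _ _ _
  rw [disjointMul, hf, hg, Finset.sum_mul, coeff_sum]
  simp_rw [Finset.mul_sum, coeff_sum, monomial_mul, coeff_monomial]
  have hterm : ∀ α ∈ f.support, (∑ β ∈ g.support,
      if Finsupp.mapDomain Sum.inl α + Finsupp.mapDomain Sum.inr β = γ then coeff α f * coeff β g else 0) =
      if α = restrInl γ then coeff α f * coeff (restrInr γ) g else 0 := by
    intro α _
    have h2 : ∀ β ∈ g.support, (if Finsupp.mapDomain Sum.inl α + Finsupp.mapDomain Sum.inr β = γ then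
        coeff α f * coeff β g else 0) = if α = restrInl γ then (if restrInr γ = β then coeff α f * coeff β g else 0) else 0 := by
      intro β _
      have hiff := (mapDomain_inl_add_mapDomain_inr_eq_iff (α := α) (β := β) (γ := γ))
      by_cases hα : α = restrInl γ
      · rw [if_pos hα]
        exact if_congr (hiff.trans ⟨fun h ↦ h.2.symm, fun h ↦ ⟨hα, h.symm⟩⟩) rfl rfl
      · rw [if_neg hα, if_neg (fun h ↦ hα (hiff.1 h).1)]
    rw [Finset.sum_congr rfl h2]
    by_cases hα : α = restrInl γ
    · simp_rw [if_pos hα]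
      rw [Finset.sum_ite_eq]
      split_ifs with hmem
      · rfl
      · rw [MvPolynomial.notMem_support_iff.1 hmem, mul_zero]
    · simp_rw [if_neg hα]; rw [Finset.sum_const_zero]
  rw [Finset.sum_congr rfl hterm, Finset.sum_ite_eq']
  split_ifs with hmem
  · rfl
  · rw [MvPolynomial.notMem_support_iff.1 hmem, zero_mul]

/-- `f(w)g(u)` has nonnegative coefficients if `f` and `g` do. [cite: BrandenHuh2019, §2.5 proof of Cor. 2.32] -/
theorem coeff_disjointMul_nonneg {f : MvPolynomial σ ℝ} {g : MvPolynomial τ ℝ} (hf : ∀ α, 0 ≤ coeff α f)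
    (hg : ∀ β, 0 ≤ coeff β g) (γ : σ ⊕ τ →₀ ℕ) : 0 ≤ coeff γ (disjointMul f g) := by
  rw [coeff_disjointMul]
  exact mul_nonneg (hf _) (hg _)

/-- `f(w)g(u)` is homogeneous of degree `d + e`. [cite: BrandenHuh2019, §2.5 proof of Cor. 2.32] -/
theorem isHomogeneous_disjointMul {f : MvPolynomial σ ℝ} {g : MvPolynomial τ ℝ} {d e : ℕ} (hf : f.IsHomogeneous d)
    (hg : g.IsHomogeneous e) : (disjointMul f g).IsHomogeneous (d + e) :=
  (hf.rename_isHomogeneous).mul (hg.rename_isHomogeneous)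

/-- **The support of `f(w)g(u)` is the product of the supports**: `γ ∈ supp` iff `γ|_σ ∈ supp f` and `γ|_τ ∈ supp g`.
[cite: BrandenHuh2019, §2.5 proof of Cor. 2.32] -/
theorem mem_support_disjointMul {f : MvPolynomial σ ℝ} {g : MvPolynomial τ ℝ} {γ : σ ⊕ τ →₀ ℕ} :
    coeff γ (disjointMul f g) ≠ 0 ↔ coeff (restrInl γ) f ≠ 0 ∧ coeff (restrInr γ) g ≠ 0 := by
  rw [coeff_disjointMul, mul_ne_zero_iff]

/-- **The support of `f(w)g(u)` is M-convex** when the supports of `f` and `g` are (exchanges happen inside `σ` or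
inside `τ`). [cite: BrandenHuh2019, §2.5 proof of Cor. 2.32 ("It is straightforward to check that `f(w)g(u)` is an
element of `L^{d+e}_{n+n}`"); §2.2 Def. 2.6 (`M^d_n`)] -/
theorem isMConvex_support_disjointMul {f : MvPolynomial σ ℝ} {g : MvPolynomial τ ℝ}
    (hf : IsMConvex {α | coeff α f ≠ 0}) (hg : IsMConvex {β | coeff β g ≠ 0}) :
    IsMConvex {γ : σ ⊕ τ →₀ ℕ | coeff γ (disjointMul f g) ≠ 0} := by
  intro x y hx hy k hk
  rw [Set.mem_setOf_eq, mem_support_disjointMul] at hx hy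
  cases k with
  | inl i =>
    have hi : restrInl y i < restrInl x i := by simpa using hk
    obtain ⟨j, hj, hmem⟩ := hf hx.1 hy.1 i hi
    refine ⟨Sum.inl j, by simpa using hj, ?_⟩
    rw [Set.mem_setOf_eq, mem_support_disjointMul, (restr_sub_inl_add_inl x i j).1, (restr_sub_inl_add_inl x i j).2]
    exact ⟨hmem, hx.2⟩
  | inr i =>
    have hi : restrInr y i < restrInr x i := by simpa using hk
    obtain ⟨j, hj, hmem⟩ := hg hx.2 hy.2 i hi
    refine ⟨Sum.inr j, by simpa using hj, ?_⟩
    rw [Set.mem_setOf_eq, mem_support_disjointMul, (restr_sub_inr_add_inr x i j).1, (restr_sub_inr_add_inr x i j).2]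
    exact ⟨hx.1, hmem⟩

/-- `∂_{u_j}` kills `f(w)`: `pderiv (inr j) (rename inl f) = 0`. [cite: BrandenHuh2019, §2.5 proof of Cor. 2.32] -/
theorem pderiv_inr_rename_inl (j : τ) (f : MvPolynomial σ ℝ) :
    pderiv (Sum.inr j) (rename (Sum.inl : σ → σ ⊕ τ) f) = 0 := by
  classical
  induction f using MvPolynomial.induction_on with
  | C c => rw [rename_C, pderiv_C]
  | add p q hp hq => rw [map_add, map_add, hp, hq, add_zero]
  | mul_X p k hp => rw [map_mul, rename_X, pderiv_mul, hp, zero_mul, zero_add, pderiv_X,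
      Pi.single_eq_of_ne Sum.inl_ne_inr, mul_zero]

/-- `∂_{w_i}` kills `g(u)`: `pderiv (inl i) (rename inr g) = 0`. [cite: BrandenHuh2019, §2.5 proof of Cor. 2.32] -/
theorem pderiv_inl_rename_inr (i : σ) (g : MvPolynomial τ ℝ) :
    pderiv (Sum.inl i) (rename (Sum.inr : τ → σ ⊕ τ) g) = 0 := by
  classical
  induction g using MvPolynomial.induction_on with
  | C c => rw [rename_C, pderiv_C]
  | add p q hp hq => rw [map_add, map_add, hp, hq, add_zero]
  | mul_X p k hp => rw [map_mul, rename_X, pderiv_mul, hp, zero_mul, zero_add, pderiv_X,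
      Pi.single_eq_of_ne Sum.inr_ne_inl, mul_zero]

/-- **`∂_{w_i} (f(w) g(u)) = (∂_i f)(w) g(u)`**. [cite: BrandenHuh2019, §2.5 proof of Cor. 2.32] -/
theorem pderiv_inl_disjointMul (i : σ) (f : MvPolynomial σ ℝ) (g : MvPolynomial τ ℝ) :
    pderiv (Sum.inl i) (disjointMul f g) = disjointMul (pderiv i f) g := by
  rw [disjointMul, pderiv_mul, pderiv_inl_rename_inr, mul_zero, add_zero,
    MvPolynomial.pderiv_rename Sum.inl_injective, disjointMul]

/-- **`∂_{u_j} (f(w) g(u)) = f(w) (∂_j g)(u)`**. [cite: BrandenHuh2019, §2.5 proof of Cor. 2.32] -/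
theorem pderiv_inr_disjointMul (j : τ) (f : MvPolynomial σ ℝ) (g : MvPolynomial τ ℝ) :
    pderiv (Sum.inr j) (disjointMul f g) = disjointMul f (pderiv j g) := by
  rw [disjointMul, pderiv_mul, pderiv_inr_rename_inl, zero_mul, zero_add,
    MvPolynomial.pderiv_rename Sum.inr_injective, disjointMul]

/-- `f(w) · c = c · f(w)` (a constant second factor). [cite: BrandenHuh2019, §2.5 proof of Cor. 2.32] -/
theorem disjointMul_C_right (f : MvPolynomial σ ℝ) (c : ℝ) :
    disjointMul f (C c : MvPolynomial τ ℝ) = c • rename Sum.inl f := by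
  rw [disjointMul, rename_C, mul_comm, smul_eq_C_mul]

/-- `c · g(u)` (a constant first factor). [cite: BrandenHuh2019, §2.5 proof of Cor. 2.32] -/
theorem disjointMul_C_left (c : ℝ) (g : MvPolynomial τ ℝ) :
    disjointMul (C c : MvPolynomial σ ℝ) g = c • rename Sum.inr g := by
  rw [disjointMul, rename_C, smul_eq_C_mul]

/-- A polynomial of `L^0` is a nonnegative constant: `f = C (coeff 0 f)`. [cite: BrandenHuh2019, §2.2 Def. 2.6 (`L^0_n`)] -/
theorem eq_C_of_mem_lorentzian_zero [Fintype σ] [DecidableEq σ] {f : MvPolynomial σ ℝ} (hf : f ∈ lorentzian σ 0) :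
    f = C (coeff 0 f) := by
  by_cases h0 : f = 0
  · rw [h0, coeff_zero, C_0]
  · exact totalDegree_eq_zero_iff_eq_C.1 ((mem_lorentzian_zero.1 hf).1.totalDegree h0)

end DisjointMul

/-! ## §3 The base case `d = e = 1`: a product of two linear forms in disjoint variables -/

section Base

variable [Fintype σ] [Fintype τ] [DecidableEq σ] [DecidableEq τ]

/-- A linear form has vanishing second coefficients: `coeff_{e_i + e_j} f = 0` for `f` homogeneous of degree `1`.
[cite: BrandenHuh2019, §2.2 Def. 2.6 (`L^1_n`)] -/
theorem coeff_add_eq_zero_of_isHomogeneous_one {ι : Type*} {f : MvPolynomial ι ℝ} (hf : f.IsHomogeneous 1) (i j : ι) :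
    coeff (Finsupp.single i 1 + Finsupp.single j 1) f = 0 :=
  hf.coeff_eq_zero (by simp)

/-- **The Hessian of `(a·w)(b·u)`** for linear forms `f = Σ a_i w_i`, `g = Σ b_j u_j`: the off-diagonal blocks `a bᵀ`, `b aᵀ`
and zero diagonal blocks. [cite: BrandenHuh2019, §2.5 proof of Cor. 2.32] -/
theorem hessian_disjointMul_of_linear {f : MvPolynomial σ ℝ} {g : MvPolynomial τ ℝ} (hf : f.IsHomogeneous 1)
    (hg : g.IsHomogeneous 1) (k l : σ ⊕ τ) :
    hessian (disjointMul f g) k l = match k, l with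
      | Sum.inl i, Sum.inr j => coeff (Finsupp.single i 1) f * coeff (Finsupp.single j 1) g
      | Sum.inr j, Sum.inl i => coeff (Finsupp.single i 1) f * coeff (Finsupp.single j 1) g
      | Sum.inl _, Sum.inl _ => 0
      | Sum.inr _, Sum.inr _ => 0 := by
  rw [hessian_apply_eq_normCoeff, normCoeff, coeff_disjointMul]
  have hrestr : ∀ (k l : σ ⊕ τ), restrInl (Finsupp.single k 1 + Finsupp.single l 1 : σ ⊕ τ →₀ ℕ) =
      restrInl (Finsupp.single k 1) + restrInl (Finsupp.single l 1) ∧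
      restrInr (Finsupp.single k 1 + Finsupp.single l 1 : σ ⊕ τ →₀ ℕ) =
      restrInr (Finsupp.single k 1) + restrInr (Finsupp.single l 1) := fun k l ↦
    ⟨Finsupp.ext fun x ↦ by simp, Finsupp.ext fun x ↦ by simp⟩
  have hl1 : ∀ i : σ, restrInl (Finsupp.single (Sum.inl i) 1 : σ ⊕ τ →₀ ℕ) = Finsupp.single i 1 := fun i ↦
    Finsupp.ext fun x ↦ by simp [Finsupp.single_apply]
  have hl2 : ∀ j : τ, restrInl (Finsupp.single (Sum.inr j) 1 : σ ⊕ τ →₀ ℕ) = 0 := fun j ↦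
    Finsupp.ext fun x ↦ by simp
  have hr1 : ∀ j : τ, restrInr (Finsupp.single (Sum.inr j) 1 : σ ⊕ τ →₀ ℕ) = Finsupp.single j 1 := fun j ↦
    Finsupp.ext fun x ↦ by simp [Finsupp.single_apply]
  have hr2 : ∀ i : σ, restrInr (Finsupp.single (Sum.inl i) 1 : σ ⊕ τ →₀ ℕ) = 0 := fun i ↦
    Finsupp.ext fun x ↦ by simp
  have hfact : ∀ (k l : σ ⊕ τ), k ≠ l → factorialProd (Finsupp.single k 1 + Finsupp.single l 1 : σ ⊕ τ →₀ ℕ) = 1 := by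
    intro k l hkl
    rw [factorialProd]
    refine Finset.prod_eq_one fun x _ ↦ ?_
    rw [Finsupp.add_apply, Finsupp.single_apply, Finsupp.single_apply]
    by_cases h1 : k = x
    · subst h1; rw [if_pos rfl, if_neg (Ne.symm hkl)]; simp
    · rw [if_neg h1]; by_cases h2 : l = x <;> simp [h2]
  cases k with
  | inl i => cases l with
    | inl i' =>
      simp only
      rw [(hrestr _ _).2, hr2, hr2, add_zero, hg.coeff_eq_zero (by simp), mul_zero, mul_zero]
    | inr j =>
      simp only
      rw [(hrestr _ _).1, (hrestr _ _).2, hl1, hl2, hr1, hr2, add_zero, zero_add, hfact _ _ Sum.inl_ne_inr, one_mul]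
  | inr j => cases l with
    | inl i =>
      simp only
      rw [(hrestr _ _).1, (hrestr _ _).2, hl1, hl2, hr1, hr2, add_zero, zero_add, hfact _ _ Sum.inr_ne_inl, one_mul]
    | inr j' =>
      simp only
      rw [(hrestr _ _).1, hl2, hl2, add_zero, hf.coeff_eq_zero (by simp), zero_mul, mul_zero]

/-- **The matrix `[[0, a bᵀ], [b aᵀ, 0]]` has at most one positive eigenvalue** (any `a ∈ ℝ^σ`, `b ∈ ℝ^τ`): its form
`2 (a·x)(b·y)` is `≤ 0` on the hyperplane orthogonal to `(‖b‖² a, ‖a‖² b)`… precisely on `{(a·x)‖b‖² + (b·y)‖a‖² = 0}`.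
[cite: BrandenHuh2019, §2.5 proof of Cor. 2.32 ("straightforward to check")] -/
theorem sigPos_rankTwo_le_one (a : σ → ℝ) (b : τ → ℝ) (H : Matrix (σ ⊕ τ) (σ ⊕ τ) ℝ)
    (hH : ∀ k l, H k l = match k, l with
      | Sum.inl i, Sum.inr j => a i * b j
      | Sum.inr j, Sum.inl i => a i * b j
      | Sum.inl _, Sum.inl _ => 0
      | Sum.inr _, Sum.inr _ => 0) :
    sigPos (Matrix.toBilin' H).toQuadraticMap ≤ 1 := by
  -- the bilinear form is `B(z, z') = (a·x)(b·y') + (b·y)(a·x')`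
  have hB : ∀ z z' : σ ⊕ τ → ℝ, Matrix.toBilin' H z z' =
      (∑ i, a i * z (Sum.inl i)) * (∑ j, b j * z' (Sum.inr j)) +
        (∑ j, b j * z (Sum.inr j)) * (∑ i, a i * z' (Sum.inl i)) := by
    intro z z'
    rw [Matrix.toBilin'_apply, Fintype.sum_sum_type]
    simp_rw [Fintype.sum_sum_type, hH, mul_zero, zero_mul, Finset.sum_const_zero, zero_add, add_zero]
    rw [Finset.sum_mul_sum, Finset.sum_mul_sum]
    congr 1
    · exact Finset.sum_congr rfl fun i _ ↦ Finset.sum_congr rfl fun j _ ↦ by ring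
    · exact Finset.sum_congr rfl fun j _ ↦ Finset.sum_congr rfl fun i _ ↦ by ring
  set w : σ ⊕ τ → ℝ := Sum.elim (fun i ↦ (∑ j, b j ^ 2) * a i) (fun j ↦ (∑ i, a i ^ 2) * b j) with hw
  refine sigPos_le_one_of_orthogonal_nonpos (Matrix.toBilin' H) (w := w) fun z hz ↦ ?_
  rw [hB] at hz ⊢
  simp only [hw, Sum.elim_inl, Sum.elim_inr] at hz
  have hA : ∑ i, a i * ((∑ j, b j ^ 2) * a i) = (∑ j, b j ^ 2) * ∑ i, a i ^ 2 := by
    rw [Finset.mul_sum]; exact Finset.sum_congr rfl fun i _ ↦ by ring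
  have hBB : ∑ j, b j * ((∑ i, a i ^ 2) * b j) = (∑ i, a i ^ 2) * ∑ j, b j ^ 2 := by
    rw [Finset.mul_sum]; exact Finset.sum_congr rfl fun j _ ↦ by ring
  rw [hA, hBB] at hz
  -- with `p = a·x`, `r = b·y`, `A = ‖a‖²`, `Bn = ‖b‖²`: `hz : p·A·Bn + r·A·Bn… `
  have hA0 : 0 ≤ ∑ i, a i ^ 2 := Finset.sum_nonneg fun _ _ ↦ sq_nonneg _
  have hB0 : 0 ≤ ∑ j, b j ^ 2 := Finset.sum_nonneg fun _ _ ↦ sq_nonneg _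
  by_cases ha : ∑ i, a i ^ 2 = 0
  · -- then `a = 0` and the form vanishes
    have ha' : ∀ i, a i = 0 := fun i ↦ by
      have := (Finset.sum_eq_zero_iff_of_nonneg fun i _ ↦ sq_nonneg (a i)).1 ha i (Finset.mem_univ i)
      exact pow_eq_zero_iff two_ne_zero |>.1 this
    simp [ha']
  by_cases hb : ∑ j, b j ^ 2 = 0
  · have hb' : ∀ j, b j = 0 := fun j ↦ by
      have := (Finset.sum_eq_zero_iff_of_nonneg fun j _ ↦ sq_nonneg (b j)).1 hb j (Finset.mem_univ j)
      exact pow_eq_zero_iff two_ne_zero |>.1 this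
    simp [hb']
  · -- `(a·x) Bn A + (b·y) A Bn… = 0` gives `(b·y) = -(a·x) Bn/A… `; then `2 (a·x)(b·y) A Bn = -2 (a·x)² Bn² A/…  ≤ 0`
    have hApos : 0 < ∑ i, a i ^ 2 := lt_of_le_of_ne hA0 (Ne.symm ha)
    have hBpos : 0 < ∑ j, b j ^ 2 := lt_of_le_of_ne hB0 (Ne.symm hb)
    have hsum : ((∑ i, a i * z (Sum.inl i)) + ∑ j, b j * z (Sum.inr j)) * ((∑ i, a i ^ 2) * ∑ j, b j ^ 2) = 0 := by
      linear_combination hz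
    have hpr : (∑ i, a i * z (Sum.inl i)) + ∑ j, b j * z (Sum.inr j) = 0 :=
      (mul_eq_zero.1 hsum).resolve_right (mul_pos hApos hBpos).ne'
    have hr : ∑ j, b j * z (Sum.inr j) = -∑ i, a i * z (Sum.inl i) := by linarith
    rw [hr]
    nlinarith [sq_nonneg (∑ i, a i * z (Sum.inl i))]

/-- **Base case: for linear forms `f ∈ L^1_σ`, `g ∈ L^1_τ`, the product `f(w)g(u)` is in `L^2_{σ ⊕ τ}`.**
[cite: BrandenHuh2019, §2.5 proof of Cor. 2.32] -/
theorem disjointMul_mem_lorentzian_one_one {f : MvPolynomial σ ℝ} {g : MvPolynomial τ ℝ} (hf : f ∈ lorentzian σ 1)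
    (hg : g ∈ lorentzian τ 1) : disjointMul f g ∈ lorentzian (σ ⊕ τ) 2 := by
  rw [mem_lorentzian_one] at hf hg
  refine mem_lorentzian_two.2 ⟨isHomogeneous_disjointMul hf.1 hg.1, coeff_disjointMul_nonneg hf.2 hg.2,
    isMConvex_support_disjointMul ?_ ?_, ?_⟩
  · exact isMConvex_support_of_mem_lorentzian (mem_lorentzian_one.2 hf)
  · exact isMConvex_support_of_mem_lorentzian (mem_lorentzian_one.2 hg)
  · exact sigPos_rankTwo_le_one (fun i ↦ coeff (Finsupp.single i 1) f) (fun j ↦ coeff (Finsupp.single j 1) g) _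
      fun k l ↦ by rw [hessian_disjointMul_of_linear hf.1 hg.1]

end Base

/-! ## §4 `f(w)g(u) ∈ L^{d+e}` and Corollary 2.32 -/

section Main

variable [Fintype σ] [Fintype τ] [DecidableEq σ] [DecidableEq τ]

/-- A constant second factor: `f ∈ L^d_σ`, `g ∈ L^0_τ` ⟹ `f(w)g(u) = g · f(w) ∈ L^d`. [cite: BrandenHuh2019, §2.5 proof
of Cor. 2.32; §2.2 Thm. 2.10 (adjoining variables)] -/
theorem disjointMul_mem_lorentzian_zero_right {d : ℕ} {f : MvPolynomial σ ℝ} {g : MvPolynomial τ ℝ}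
    (hf : f ∈ lorentzian σ d) (hg : g ∈ lorentzian τ 0) : disjointMul f g ∈ lorentzian (σ ⊕ τ) d := by
  rw [eq_C_of_mem_lorentzian_zero hg, disjointMul_C_right]
  exact smul_mem_lorentzian (rename_mem_lorentzian Sum.inl_injective hf) ((mem_lorentzian_zero.1 hg).2 0)

/-- A constant first factor. [cite: BrandenHuh2019, §2.5 proof of Cor. 2.32; §2.2 Thm. 2.10] -/
theorem disjointMul_mem_lorentzian_zero_left {e : ℕ} {f : MvPolynomial σ ℝ} {g : MvPolynomial τ ℝ}
    (hf : f ∈ lorentzian σ 0) (hg : g ∈ lorentzian τ e) : disjointMul f g ∈ lorentzian (σ ⊕ τ) e := by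
  rw [eq_C_of_mem_lorentzian_zero hf, disjointMul_C_left]
  exact smul_mem_lorentzian (rename_mem_lorentzian Sum.inr_injective hg) ((mem_lorentzian_zero.1 hf).2 0)

/-- The induction on `d + e` behind `disjointMul_mem_lorentzian`. [cite: BrandenHuh2019, §2.5 proof of Cor. 2.32;
§2.2 Def. 2.6] -/
private theorem disjointMul_mem_lorentzian_aux : ∀ (n : ℕ) {d e : ℕ}, d + e = n →
    ∀ {f : MvPolynomial σ ℝ} {g : MvPolynomial τ ℝ}, f ∈ lorentzian σ d → g ∈ lorentzian τ e →
      disjointMul f g ∈ lorentzian (σ ⊕ τ) n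
  | 0, d, e, h, f, g, hf, hg => by
    obtain ⟨rfl, rfl⟩ : d = 0 ∧ e = 0 := by omega
    exact disjointMul_mem_lorentzian_zero_right hf hg
  | 1, d, e, h, f, g, hf, hg => by
    rcases Nat.eq_zero_or_pos d with rfl | hd
    · obtain rfl : e = 1 := by omega
      exact disjointMul_mem_lorentzian_zero_left hf hg
    · obtain rfl : d = 1 := by omega
      obtain rfl : e = 0 := by omega
      exact disjointMul_mem_lorentzian_zero_right hf hg
  | 2, d, e, h, f, g, hf, hg => by
    rcases Nat.eq_zero_or_pos d with rfl | hd
    · obtain rfl : e = 2 := by omega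
      exact disjointMul_mem_lorentzian_zero_left hf hg
    rcases Nat.eq_zero_or_pos e with rfl | he
    · obtain rfl : d = 2 := by omega
      exact disjointMul_mem_lorentzian_zero_right hf hg
    · obtain rfl : d = 1 := by omega
      obtain rfl : e = 1 := by omega
      exact disjointMul_mem_lorentzian_one_one hf hg
  | n + 3, d, e, h, f, g, hf, hg => by
    rw [mem_lorentzian_add_three]
    refine ⟨h ▸ isHomogeneous_disjointMul (isHomogeneous_of_mem_lorentzian hf) (isHomogeneous_of_mem_lorentzian hg),
      coeff_disjointMul_nonneg (coeff_nonneg_of_mem_lorentzian hf) (coeff_nonneg_of_mem_lorentzian hg),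
      isMConvex_support_disjointMul (isMConvex_support_of_mem_lorentzian hf) (isMConvex_support_of_mem_lorentzian hg),
      fun k ↦ ?_⟩
    cases k with
    | inl i =>
      rw [pderiv_inl_disjointMul]
      rcases d with _ | d
      · rw [eq_C_of_mem_lorentzian_zero hf, pderiv_C, disjointMul_def, map_zero, zero_mul]
        exact zero_mem_lorentzian _
      · exact disjointMul_mem_lorentzian_aux (n + 2) (by omega) (pderiv_mem_lorentzian hf i) hg
    | inr j =>
      rw [pderiv_inr_disjointMul]
      rcases e with _ | e
      · rw [eq_C_of_mem_lorentzian_zero hg, pderiv_C, disjointMul_def, map_zero, mul_zero]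
        exact zero_mem_lorentzian _
      · exact disjointMul_mem_lorentzian_aux (n + 2) (by omega) hf (pderiv_mem_lorentzian hg j)

/-- **"`f(w)g(u)` is an element of `L^{d+e}_{n+n}`"**: for `f ∈ L^d_σ` and `g ∈ L^e_τ` the product in disjoint variables
is in `L^{d+e}_{σ ⊕ τ}`. [cite: BrandenHuh2019, §2.5 proof of Cor. 2.32] -/
theorem disjointMul_mem_lorentzian {d e : ℕ} {f : MvPolynomial σ ℝ} {g : MvPolynomial τ ℝ} (hf : f ∈ lorentzian σ d)
    (hg : g ∈ lorentzian τ e) : disjointMul f g ∈ lorentzian (σ ⊕ τ) (d + e) :=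
  disjointMul_mem_lorentzian_aux (d + e) rfl hf hg

omit [Fintype σ] [DecidableEq σ] in
/-- Setting `u = w`: `f · g = (f(w)g(u))|_{u = w}`, the substitution `rename (Sum.elim id id)`.
[cite: BrandenHuh2019, §2.5 proof of Cor. 2.32 ("setting `u = w`")] -/
theorem rename_sumElim_disjointMul (f g : MvPolynomial σ ℝ) :
    rename (Sum.elim id id : σ ⊕ σ → σ) (disjointMul f g) = f * g := by
  have h1 : (Sum.elim id id : σ ⊕ σ → σ) ∘ Sum.inl = id := rfl
  have h2 : (Sum.elim id id : σ ⊕ σ → σ) ∘ Sum.inr = id := rfl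
  rw [disjointMul, map_mul, rename_rename, rename_rename, h1, h2, rename_id_apply, rename_id_apply]

/-- **Brändén–Huh, Corollary 2.32: the product of Lorentzian polynomials is Lorentzian** — `f ∈ L^d_n`, `g ∈ L^e_n` ⟹
`f g ∈ L^{d+e}_n` ("`f(w)g(w)` is an element of `L^{d+e}_n`, since setting `u = w` preserves the Lorentzian property by
Theorem 2.10"). [cite: BrandenHuh2019, §2.5 Cor. 2.32 (with Thm. 2.30: strongly log-concave = Lorentzian for homogeneous
polynomials)] -/
theorem mul_mem_lorentzian {d e : ℕ} {f g : MvPolynomial σ ℝ} (hf : f ∈ lorentzian σ d) (hg : g ∈ lorentzian σ e) :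
    f * g ∈ lorentzian σ (d + e) := by
  rw [← rename_sumElim_disjointMul f g]
  exact rename_mem_lorentzian_of_any _ (disjointMul_mem_lorentzian hf hg)

/-- Powers of a Lorentzian polynomial are Lorentzian: `f ∈ L^d ⟹ f^k ∈ L^{kd}`. [cite: BrandenHuh2019, §2.5 Cor. 2.32] -/
theorem pow_mem_lorentzian {d : ℕ} {f : MvPolynomial σ ℝ} (hf : f ∈ lorentzian σ d) :
    ∀ k : ℕ, f ^ k ∈ lorentzian σ (k * d)
  | 0 => by
    rw [pow_zero, zero_mul]
    exact mem_lorentzian_zero.2 ⟨isHomogeneous_one σ ℝ, fun α ↦ by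
      rw [coeff_one]; split_ifs <;> norm_num⟩
  | k + 1 => by
    rw [pow_succ, add_mul, one_mul]
    exact mul_mem_lorentzian (pow_mem_lorentzian hf k) hf

/-- Finite products of Lorentzian polynomials are Lorentzian: `Π_{i∈s} f_i ∈ L^{Σ d_i}`. [cite: BrandenHuh2019, §2.5
Cor. 2.32] -/
theorem prod_mem_lorentzian {ι : Type*} (s : Finset ι) {d : ι → ℕ} {f : ι → MvPolynomial σ ℝ}
    (hf : ∀ i ∈ s, f i ∈ lorentzian σ (d i)) : ∏ i ∈ s, f i ∈ lorentzian σ (∑ i ∈ s, d i) := by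
  classical
  induction s using Finset.induction_on with
  | empty =>
    rw [Finset.prod_empty, Finset.sum_empty]
    exact mem_lorentzian_zero.2 ⟨isHomogeneous_one σ ℝ, fun α ↦ by
      rw [coeff_one]; split_ifs <;> norm_num⟩
  | insert a s ha ih =>
    rw [Finset.prod_insert ha, Finset.sum_insert ha]
    exact mul_mem_lorentzian (hf a (Finset.mem_insert_self a s)) (ih fun i hi ↦ hf i (Finset.mem_insert_of_mem hi))

end Main

end Literature.Combinatorics.LorentzianPolynomials

end
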